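/-
Copyright (c) 2026. All rights reserved.
Released under Apache 2.0 license as described in the file LICENSE.
Authors: abc-iut cell, seat abc-iut-L4-t10 (gen 3; node `AbsTopIII:Cor4.5(iii)` second clause — its typed
CONTENT `IotaOverGaloisStmt` at the archimedean model).
-/
import Literature.AnabelianGeometry.AbsoluteAnabelian.AbsTopIII.AutHolLogFrobeniusModelProofs
import HarnessLib

/-!
# [AbsTopIII] Cor 4.5 (iii), second clause, AT THE ARCHIMEDEAN MODEL: `ι_×`, `ι_log` lie over `EA`

S. Mochizuki, *Topics in absolute anabelian geometry III*, Cor 4.5 (iii) p. 109 l. 2–5 ("[the family of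
homotopies of `𝔖_log`] is compatible with the families of homotopies that constitute the core and telecore
structures of (i), (ii)") with its proof p. 110 / p. 81 ("immediate from the definitions — i.e., in
essence, because the various [base objects] that appear remain 'undisturbed' by the various manipulations
involving arithmetic data that arise from '`ι_{log,⋎}`', '`ι_×`'"); kurims manuscript (lit key
`paper:url-5493eb38cbb7`, read on the page; bib key `MochizukiAbsTopIII2015`).  PROOF-ONLY companion
(abc-iut cell, node `AbsTopIII:Cor4.5(iii)`; no declaration) of `ArchimedeanLogFrobeniusModel.lean` /
`AbsTopIII/AutHolLogFrobeniusModelProofs.lean` (seat abc-iut-L4-t10).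

abc-iut-L4-t5 types the CONTENT of the compatibility clause of Cor 3.6 (iii) / 4.5 (iii) as
`LogFrobeniusData.IotaOverGaloisStmt` (`FrobeniusPictureMLFTelecore.lean`): after the projection `𝒩 → ℰ`
the component of `ι_×` at `x` is the identity of `(𝒳 → ℰ)(x)` (through `λ^× ⋙ (𝒩 → ℰ) = (𝒳 → ℰ) =
λ^∼ ⋙ (𝒩 → ℰ)`), and that of `ι_{log,⋎}` is the isomorphism induced by `log ≅ 𝟭` — the gluing condition
under which ONE family of homotopies on `𝒟` contains `𝔖_log` and the cores (abc-iut-L4-t5's reduction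
`logObsCompatCoresStmt_of_pull`, `FrobeniusPictureMLFCompatibilityTransport.lean`); it is PROVED for the
MLF-Galois model (`TFModel.iotaOverGaloisStmt_model`).  Here it is PROVED for the ARCHIMEDEAN model
`archLogFrobeniusData 𝔄` over every interface datum `𝔄 : AutHolFieldFunctor` (Cor 2.7 (e) + functoriality):

* `AbsTopIII.arch_iotaOverGaloisStmt 𝔄 : (archLogFrobeniusData 𝔄).IotaOverGaloisStmt` — TRUE BY
  CONSTRUCTION: `ι_×` (`exp_k : k~ ↠ k^×`) and `ι_log` (`(k~)^× ↪ k~`) act on arithmetic data only; their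
  structure-orbispace components are `𝟙 𝕏` (`HolTFPair.iotaTimesApp`, `iotaLogApp`), `ℰ = EA` receives
  `𝒩 = 𝒞^hol_TH` by `(𝕏 ↶ M) ↦ 𝕏`, and `log = 𝔩𝔬𝔤_{TF,TF}`, `id_⋎` are identity functors in this realisation.

Hence the archimedean model meets the input of the literal compatibility clause `Cor_4_5_iii_compat`
(`AbsTopIII/AutHolLogFrobeniusCompatibility.lean`) as soon as the generic one-family construction over
`IotaOverGaloisStmt` lands (abc-iut-L4-t5 lineage); nothing here asserts that clause.  Refereed pre-IUT
anabelian geometry; nothing here bears on [IUTchIII] Cor. 3.12 or takes a side; model ≠ reconstruction.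
-/

set_option autoImplicit false

namespace Literature.AnabelianGeometry.AbsoluteAnabelian.AbsTopIII

open _root_.CategoryTheory

universe u

/-- A morphism between propositionally equal objects that is heterogeneously the identity is the
`eqToHom`. [folklore] -/
private theorem eq_eqToHom_of_heq_id' {C : Type*} [Category C] {a b : C} (h : a = b) (f : a ⟶ b)
    (hf : HEq f (𝟙 a)) : f = eqToHom h := by
  cases h
  simpa using hf

/-- `f = eqToHom ≫ m ≫ eqToHom` for morphisms between propositionally equal objects that are
heterogeneously identities. [folklore] -/
private theorem eq_eqToHom_comp_of_heq_id' {C : Type*} [Category C] {a b c d : C} (h₁ : a = b)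
    (h₃ : b = c) (h₂ : c = d) (f : a ⟶ d) (m : b ⟶ c) (hm : HEq m (𝟙 b)) (hf : HEq f (𝟙 a)) :
    f = eqToHom h₁ ≫ m ≫ eqToHom h₂ := by
  cases h₁
  cases h₃
  cases h₂
  have hm' : m = 𝟙 _ := eq_of_heq hm
  have hf' : f = 𝟙 _ := eq_of_heq hf
  subst hm' hf'
  simp

variable (𝔄 : AutHolFieldFunctor.{u})

/-- The structure-orbispace component of `ι_×` at every pair is the identity: `(𝒩 → ℰ)(ι_{×,x}) = 𝟙 𝕏`.
[cite: MochizukiAbsTopIII2015, Corollary 4.5 (iii) p.109] -/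
theorem arch_NtoE_map_iotaTimes (x : HolTFPair 𝔄) :
    (HolTHPair.toEA 𝔄).map ((HolTFPair.iotaTimes 𝔄).app x) = 𝟙 x.X := rfl

/-- The structure-orbispace component of `ι_log` at every pair is the identity: `(𝒩 → ℰ)(ι_{log,x}) = 𝟙 𝕏`.
[cite: MochizukiAbsTopIII2015, Corollary 4.5 (iii) p.109] -/
theorem arch_NtoE_map_iotaLog (x : HolTFPair 𝔄) :
    (HolTHPair.toEA 𝔄).map ((HolTFPair.iotaLog 𝔄).app x) = 𝟙 x.X := rfl

/-- **[AbsTopIII] Cor 4.5 (iii), second clause — CONTENT, AT THE ARCHIMEDEAN MODEL**: for the input data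
`archLogFrobeniusData 𝔄` of Cor 4.5 over any interface datum `𝔄`, the natural transformations `ι_×` and
`ι_{log,⋎}` lie over the identity of `ℰ = EA` (abc-iut-L4-t5's `IotaOverGaloisStmt`) — "immediate from the
definitions": both act on arithmetic data only, with structure-orbispace component `𝟙 𝕏`, and `log`,
`id_⋎` are identity functors here. [cite: MochizukiAbsTopIII2015, Corollary 4.5 (iii) p.109] -/
theorem arch_iotaOverGaloisStmt : (archLogFrobeniusData 𝔄).IotaOverGaloisStmt := by
  refine ⟨?_, ?_⟩
  · show ∀ x : HolTFPair 𝔄, (HolTHPair.toEA 𝔄).map ((HolTFPair.iotaTimes 𝔄).app x) = eqToHom _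
    intro x
    exact eq_eqToHom_of_heq_id' _ _ (heq_of_eq (arch_NtoE_map_iotaTimes 𝔄 x))
  · intro x
    exact eq_eqToHom_comp_of_heq_id' _ rfl _ _ _ (heq_of_eq rfl)
      (heq_of_eq (arch_NtoE_map_iotaLog 𝔄 x))

end Literature.AnabelianGeometry.AbsoluteAnabelian.AbsTopIII
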